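import Mathlib.RingTheory.Nakayama
import Mathlib.Algebra.MvPolynomial.PDeriv
import Mathlib.RingTheory.MvPolynomial.Basic
import Summits.ResolutionOfSingularities.ResolutionOfSingularities.Theorems.FrobeniusLadderFInjectiveMacaulayficationPencilExitTagMaster
import HarnessLib

/-!
# Regular systems of parameters of the local ring of a hypersurface chart `V(θ) ⊂ 𝔸ⁿ` at a rational point, from the Jacobian
# (BED Ω₁ GLOBAL PATCH, F6 v2 §4 F4: `B = 𝒪_{X̃₂,x̃} = (k[y]/(θ_c))_{x̃}`; the letters `y_i − c_i`, `i ≠ l`, for `∂θ/∂y_l(c) ≠ 0`, and the swap-in of a second function `w` through a `2 × 2` minor;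
# crux `FInjectiveMacaulayfication` stmt-ResolutionOfSingularities-15315, chain w45a; seat res-L1-w45a-stub-3 g15)

[OURS · L1 W4.5a] Support file (`--supports stmt-ResolutionOfSingularities-15315 --as helper`); theorems only; GENERIC (any field, any `θ`); no named fact; NOT a statement of any
manuscript; nothing of the crux is proved. AI-written (AI review is weaker than expert review).

* §1 Nakayama bookkeeping in a Noetherian local ring: `ofList_eq_of_mem_sup_sq` (drop a generator lying in the others `+ 𝔪²`), `ofList_cons_eq_of_sub_mem` (swap `x` for `w ≡ u·x`, `u` a unit);
* §2 `taylor_two` — `g − g(c) − Σᵢ ∂ᵢg(c)·(yᵢ − cᵢ) ∈ 𝔭_c²` for every `g ∈ k[y₁,…,yₙ]`;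
* §3 for an ABSTRACT Noetherian local ring `B` and `φ : k[y] → B` with `φ θ = 0`, `𝔭_c·B = 𝔪_B` (e.g. `B = 𝒪_{V(θ),c}`): ★★ `ofList_erase_eq_maximalIdeal` — if `∂θ/∂y_l(c) ≠ 0` the
  `φ(yᵢ − cᵢ)`, `i ≠ l`, generate `𝔪_B`; ★★ `ofList_swap_eq_maximalIdeal` — if moreover `w(c) = 0` and the minor `∂_lθ·∂_{i₀}w − ∂_{i₀}θ·∂_l w` is nonzero at `c` (`i₀ ≠ l`), then
  `φ w` and the `φ(yᵢ − cᵢ)`, `i ≠ l, i₀`, generate `𝔪_B`.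
Dimension, regularity and the residue field of the concrete models are in the sequel file.
[cite: Matsumura1987, Thm. 2.3, Thm. 14.2; Hartshorne1977, I Thm. 5.1]
-/

set_option linter.dupNamespace false

noncomputable section

namespace Summit.ResolutionOfSingularities.ResolutionOfSingularities.Theorems.FInjectiveMacaulayfication.ChartPointParameters

open IsLocalRing MvPolynomial

universe u

/-! ## §1 Nakayama bookkeeping -/

section Nakayama

variable {R : Type u} [CommRing R] [IsLocalRing R] [IsNoetherianRing R]

/-- If `𝔪 = (x, t)` and `x ∈ (t) + 𝔪²` then `𝔪 = (t)` (Nakayama). [cite: Matsumura1987, Thm. 2.3] -/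
theorem ofList_eq_of_mem_sup_sq (x : R) (t : List R) (hgen : Ideal.ofList (x :: t) = maximalIdeal R)
    (hx : x ∈ Ideal.ofList t ⊔ maximalIdeal R ^ 2) : Ideal.ofList t = maximalIdeal R := by
  have hle : Ideal.ofList t ≤ maximalIdeal R := by rw [← hgen, Ideal.ofList_cons]; exact le_sup_right
  refine le_antisymm hle ?_
  have hN : (maximalIdeal R) ≤ Ideal.ofList t ⊔ maximalIdeal R • maximalIdeal R := by
    have h2 : maximalIdeal R • maximalIdeal R = maximalIdeal R ^ 2 := by rw [smul_eq_mul, pow_two]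
    rw [h2]
    conv_lhs => rw [← hgen]
    rw [Ideal.ofList_cons]
    exact sup_le ((Ideal.span_singleton_le_iff_mem _).mpr hx) le_sup_left
  exact Submodule.le_of_le_smul_of_le_jacobson_bot (IsNoetherian.noetherian _) (IsLocalRing.maximalIdeal_le_jacobson ⊥) hN

/-- If `𝔪 = (x, t)`, `w ∈ 𝔪` and `w − u·x ∈ (t) + 𝔪²` for a unit `u`, then `𝔪 = (w, t)`. [cite: Matsumura1987, Thm. 2.3] -/
theorem ofList_cons_eq_of_sub_mem (x w u : R) (t : List R) (hgen : Ideal.ofList (x :: t) = maximalIdeal R) (hw : w ∈ maximalIdeal R) (hu : IsUnit u)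
    (hwx : w - u * x ∈ Ideal.ofList t ⊔ maximalIdeal R ^ 2) : Ideal.ofList (w :: t) = maximalIdeal R := by
  -- `𝔪 = (x, w, t)`
  have hgen' : Ideal.ofList (x :: w :: t) = maximalIdeal R := by
    rw [Ideal.ofList_cons, Ideal.ofList_cons, ← sup_assoc, sup_comm (Ideal.span {x}), sup_assoc, ← Ideal.ofList_cons, hgen, sup_eq_right]
    exact (Ideal.span_singleton_le_iff_mem _).mpr hw
  refine ofList_eq_of_mem_sup_sq x (w :: t) hgen' ?_
  -- `x = u⁻¹ (w - (w - u x)) ∈ (w) + (t) + 𝔪²`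
  obtain ⟨a, ha, b, hb, hab⟩ := Submodule.mem_sup.mp hwx
  have hx : x = ↑hu.unit⁻¹ * w - ↑hu.unit⁻¹ * a - ↑hu.unit⁻¹ * b := by
    have h1 : (↑hu.unit⁻¹ : R) * (u * x) = x := by rw [← mul_assoc, IsUnit.val_inv_mul, one_mul]
    rw [← h1, show u * x = w - a - b by linear_combination hab]; ring
  rw [hx, Ideal.ofList_cons]
  refine Ideal.sub_mem _ (Ideal.sub_mem _ ?_ ?_) ?_
  · exact Ideal.mem_sup_left (Ideal.mem_sup_left (Ideal.mul_mem_left _ _ (Ideal.mem_span_singleton_self w)))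
  · exact Ideal.mem_sup_left (Ideal.mem_sup_right (Ideal.mul_mem_left _ _ ha))
  · exact Ideal.mem_sup_right (Ideal.mul_mem_left _ _ hb)

omit [IsLocalRing R] [IsNoetherianRing R] in
/-- Reordering: `(x, y, t) = (y, x, t)`. [plumbing] -/
theorem ofList_cons_cons_comm (x y : R) (t : List R) : Ideal.ofList (x :: y :: t) = Ideal.ofList (y :: x :: t) := by
  rw [Ideal.ofList_cons, Ideal.ofList_cons, Ideal.ofList_cons, Ideal.ofList_cons, ← sup_assoc, ← sup_assoc, sup_comm (Ideal.span {x})]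

end Nakayama

/-! ## §2 Second-order Taylor expansion at a rational point -/

section Taylor

variable {k : Type} [Field k] {n : ℕ}

/-- The maximal ideal of the rational point `c`: `𝔭_c = (yᵢ − cᵢ : i)`. [folklore] -/
theorem eval_mem_pointIdeal_iff (c : Fin n → k) (g : MvPolynomial (Fin n) k) :
    g ∈ Ideal.span (Set.range fun i : Fin n => (X i : MvPolynomial (Fin n) k) - C (c i)) ↔ eval c g = 0 :=
  ⟨PencilExitTagMaster.eval_eq_zero_of_mem_span k c g, PencilExitTagMaster.mem_span_of_eval_eq_zero k c g⟩

/-- Evaluation of the Kronecker family `Pi.single i 1` of polynomials. [plumbing] -/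
theorem eval_pi_single (c : Fin n → k) (i j : Fin n) :
    eval c (Pi.single (M := fun _ => MvPolynomial (Fin n) k) i 1 j) = Pi.single (M := fun _ => k) i 1 j := by
  rcases eq_or_ne j i with rfl | hij
  · rw [Pi.single_eq_same, Pi.single_eq_same, map_one]
  · rw [Pi.single_eq_of_ne hij, Pi.single_eq_of_ne hij, map_zero]

/-- ★ **Second-order Taylor**: `g − g(c) − Σᵢ ∂ᵢg(c)·(yᵢ − cᵢ) ∈ 𝔭_c²`. [folklore] -/
theorem taylor_two (c : Fin n → k) (g : MvPolynomial (Fin n) k) :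
    g - C (eval c g) - ∑ i : Fin n, C (eval c (pderiv i g)) * (X i - C (c i)) ∈
      (Ideal.span (Set.range fun i : Fin n => (X i : MvPolynomial (Fin n) k) - C (c i))) ^ 2 := by
  induction g using MvPolynomial.induction_on with
  | C a =>
    have : (C a : MvPolynomial (Fin n) k) - C (eval c (C a)) - ∑ i : Fin n, C (eval c (pderiv i (C a))) * (X i - C (c i)) = 0 := by
      simp only [pderiv_C, map_zero, eval_C, zero_mul, Finset.sum_const_zero, sub_self]
    rw [this]; exact Ideal.zero_mem _
  | add f g hf hg =>
    have : f + g - C (eval c (f + g)) - ∑ i : Fin n, C (eval c (pderiv i (f + g))) * (X i - C (c i)) =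
        (f - C (eval c f) - ∑ i : Fin n, C (eval c (pderiv i f)) * (X i - C (c i))) +
        (g - C (eval c g) - ∑ i : Fin n, C (eval c (pderiv i g)) * (X i - C (c i))) := by
      simp only [map_add, add_mul, Finset.sum_add_distrib]; ring
    rw [this]; exact Ideal.add_mem _ hf hg
  | mul_X f j hf =>
    have hXj : (X j : MvPolynomial (Fin n) k) - C (c j) ∈ Ideal.span (Set.range fun i : Fin n => (X i : MvPolynomial (Fin n) k) - C (c i)) :=
      Ideal.subset_span ⟨j, rfl⟩
    have h1 : ∀ i : Fin n, C (eval c (pderiv i (f * X j))) * (X i - C (c i)) =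
        C (c j) * (C (eval c (pderiv i f)) * (X i - C (c i))) + C (eval c f) * (C (Pi.single (M := fun _ => k) i 1 j) * (X i - C (c i))) := by
      intro i
      rw [Derivation.leibniz, pderiv_X, smul_eq_mul, smul_eq_mul, map_add, map_mul, map_mul, eval_X, eval_pi_single]
      simp only [map_mul, map_add]; ring
    have h2 : ∑ i : Fin n, C (Pi.single (M := fun _ => k) i (1 : k) j) * ((X i : MvPolynomial (Fin n) k) - C (c i)) = X j - C (c j) := by
      rw [Finset.sum_eq_single j]
      · rw [Pi.single_eq_same, C_1, one_mul]
      · intro i _ hij; rw [Pi.single_eq_of_ne (Ne.symm hij), C_0, zero_mul]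
      · intro h; exact absurd (Finset.mem_univ j) h
    have key : f * X j - C (eval c (f * X j)) - ∑ i : Fin n, C (eval c (pderiv i (f * X j))) * (X i - C (c i)) =
        X j * (f - C (eval c f) - ∑ i : Fin n, C (eval c (pderiv i f)) * (X i - C (c i))) +
        (X j - C (c j)) * ∑ i : Fin n, C (eval c (pderiv i f)) * (X i - C (c i)) := by
      simp only [h1, Finset.sum_add_distrib, ← Finset.mul_sum, map_mul, eval_X, h2]
      ring
    rw [key]
    refine Ideal.add_mem _ (Ideal.mul_mem_left _ _ hf) ?_
    rw [pow_two]
    exact Ideal.mul_mem_mul hXj (Ideal.sum_mem _ fun i _ => Ideal.mul_mem_left _ _ (Ideal.subset_span ⟨i, rfl⟩))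

/-- For `g` vanishing at `c`: `g − Σᵢ ∂ᵢg(c)·(yᵢ − cᵢ) ∈ 𝔭_c²`. [folklore] -/
theorem taylor_two_of_eval_eq_zero (c : Fin n → k) (g : MvPolynomial (Fin n) k) (hg : eval c g = 0) :
    g - ∑ i : Fin n, C (eval c (pderiv i g)) * (X i - C (c i)) ∈
      (Ideal.span (Set.range fun i : Fin n => (X i : MvPolynomial (Fin n) k) - C (c i))) ^ 2 := by
  have := taylor_two c g
  rwa [hg, C_0, sub_zero] at this

end Taylor


/-! ## §3 Regular systems of parameters of a local ring `B` receiving `k[y]` with `θ ↦ 0` and `𝔭_c·B = 𝔪_B`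

Stated for an ABSTRACT Noetherian local ring `B` and a ring map `φ : k[y] → B` killing `θ` with `𝔭_c B = 𝔪_B` (instances: the stalk `𝒪_{V(θ),c}`, the localization `(k[y]/(θ))_c`,
the quotient `k[y]_c/(θ)`), so that no computation happens inside a concrete localization. -/

section Point

variable {k : Type} [Field k] {n : ℕ} (θ : MvPolynomial (Fin n) k) (c : Fin n → k)
  {B : Type} [CommRing B] [IsLocalRing B] (φ : MvPolynomial (Fin n) k →+* B)
  (hφθ : φ θ = 0) (hφ : (Ideal.span (Set.range fun i : Fin n => (X i : MvPolynomial (Fin n) k) - C (c i))).map φ = maximalIdeal B)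

include hφ in
/-- `𝔪_B` is generated by the `φ(yᵢ − cᵢ)`. [folklore] -/
theorem maximalIdeal_eq_span : maximalIdeal B = Ideal.span (Set.range fun i : Fin n => φ (X i - C (c i))) := by
  rw [← hφ, Ideal.map_span, ← Set.range_comp]
  rfl

include hφ in
/-- `𝔪_B` as the ideal of the LIST of the `φ(yᵢ − cᵢ)`. [folklore] -/
theorem ofList_finRange_eq_maximalIdeal : Ideal.ofList ((List.finRange n).map fun i => φ (X i - C (c i))) = maximalIdeal B := by
  rw [maximalIdeal_eq_span c φ hφ, Ideal.ofList]
  congr 1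
  ext r
  simp only [Set.mem_setOf_eq, List.mem_map, List.mem_finRange, true_and, Set.mem_range]

include hφ in
/-- An element of `𝔭_c` maps into `𝔪_B`. [plumbing] -/
theorem map_mem_maximalIdeal (g : MvPolynomial (Fin n) k) (hg : eval c g = 0) : φ g ∈ maximalIdeal B := by
  rw [← hφ]
  exact Ideal.mem_map_of_mem _ ((eval_mem_pointIdeal_iff c g).mpr hg)

include hφ in
/-- The image of `𝔭_c²` lies in `𝔪_B²`. [plumbing] -/
theorem map_pointIdeal_sq_le : ((Ideal.span (Set.range fun i : Fin n => (X i : MvPolynomial (Fin n) k) - C (c i))) ^ 2).map φ ≤ maximalIdeal B ^ 2 := by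
  rw [Ideal.map_pow, hφ]

omit [IsLocalRing B] in
/-- Nonzero scalars map to units. [plumbing] -/
theorem isUnit_map_C (a : k) (ha : a ≠ 0) : IsUnit (φ (C a)) :=
  ((Ne.isUnit ha).map C).map φ

include hφ in
/-- ★ **First-order expansion in `B`**: for `g` vanishing at `c`, `φ g − Σᵢ φ(∂ᵢg(c))·φ(yᵢ − cᵢ) ∈ 𝔪_B²`. [folklore] -/
theorem image_sub_sum_mem_sq (g : MvPolynomial (Fin n) k) (hg : eval c g = 0) (z : Fin n → B) (hz : ∀ i, z i = φ (X i - C (c i))) :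
    φ g - ∑ i : Fin n, φ (C (eval c (pderiv i g))) * z i ∈ maximalIdeal B ^ 2 := by
  have h0 := taylor_two_of_eval_eq_zero c g hg
  set t : Fin n → MvPolynomial (Fin n) k := fun i => X i - C (c i) with ht
  have h := map_pointIdeal_sq_le c φ hφ (Ideal.mem_map_of_mem φ h0)
  have hzt : ∀ i, φ (t i) = z i := fun i => by rw [hz i]
  have himg : φ (g - ∑ i : Fin n, C (eval c (pderiv i g)) * t i) = φ g - ∑ i : Fin n, φ (C (eval c (pderiv i g))) * z i := by
    rw [map_sub, map_sum φ]
    congr 1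
    refine Finset.sum_congr rfl fun i _ => ?_
    rw [map_mul, hzt]
  rw [himg] at h
  exact h

/-- Lists with the same members generate the same ideal. [plumbing] -/
theorem ofList_eq_of_perm {R : Type u} [CommRing R] {l₁ l₂ : List R} (h : l₁.Perm l₂) : Ideal.ofList l₁ = Ideal.ofList l₂ := by
  rw [Ideal.ofList, Ideal.ofList]
  congr 1
  ext r
  simp only [Set.mem_setOf_eq, h.mem_iff]

variable [IsNoetherianRing B]

include hφθ hφ in
/-- ★★ **THE `φ(yᵢ − cᵢ)`, `i ≠ l`, GENERATE `𝔪_B` WHEN `∂θ/∂y_l(c) ≠ 0`** (for any family `z` with `z i = φ(yᵢ − cᵢ)`). [cite: Matsumura1987, Thm. 2.3; Hartshorne1977, I Thm. 5.1] -/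
theorem ofList_erase_eq_maximalIdeal (hθ : eval c θ = 0) (l : Fin n) (hl : eval c (pderiv l θ) ≠ 0) (z : Fin n → B) (hz : ∀ i, z i = φ (X i - C (c i))) :
    Ideal.ofList (((List.finRange n).erase l).map z) = maximalIdeal B := by
  classical
  obtain ⟨d, hd⟩ : ∃ d : Fin n → B, ∀ i, d i = φ (C (eval c (pderiv i θ))) := ⟨_, fun i => rfl⟩
  -- `𝔪 = (z_l, z_i : i ≠ l)`
  have hall : Ideal.ofList ((List.finRange n).map z) = maximalIdeal B := by
    have hfun : z = fun i => φ (X i - C (c i)) := funext hz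
    rw [hfun]; exact ofList_finRange_eq_maximalIdeal c φ hφ
  have hperm : ((List.finRange n).map z).Perm (z l :: ((List.finRange n).erase l).map z) := by
    rw [← List.map_cons]
    exact (List.perm_cons_erase (List.mem_finRange l)).map z
  have hgen : Ideal.ofList (z l :: ((List.finRange n).erase l).map z) = maximalIdeal B := by
    rw [← ofList_eq_of_perm hperm]; exact hall
  refine ofList_eq_of_mem_sup_sq (z l) _ hgen ?_
  -- Taylor for `θ`: `Σ dᵢ zᵢ ∈ 𝔪²`
  have ht : ∑ i : Fin n, d i * z i ∈ maximalIdeal B ^ 2 := by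
    have h := image_sub_sum_mem_sq c φ hφ θ hθ z hz
    rw [hφθ, zero_sub, neg_mem_iff] at h
    have hdf : (fun i => φ (C (eval c (pderiv i θ))) * z i) = fun i => d i * z i := funext fun i => by rw [hd]
    rwa [hdf] at h
  rw [← Finset.add_sum_erase Finset.univ _ (Finset.mem_univ l)] at ht
  -- the other terms lie in `(z_i : i ≠ l)`
  have hrest : ∑ i ∈ Finset.univ.erase l, d i * z i ∈ Ideal.ofList (((List.finRange n).erase l).map z) := by
    refine Ideal.sum_mem _ fun i hi => Ideal.mul_mem_left _ _ (Ideal.subset_span ?_)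
    rw [Finset.mem_erase] at hi
    exact List.mem_map.mpr ⟨i, (List.mem_erase_of_ne hi.1).mpr (List.mem_finRange i), rfl⟩
  have hdl : IsUnit (d l) := by rw [hd]; exact isUnit_map_C φ _ hl
  have key : d l * z l ∈ Ideal.ofList (((List.finRange n).erase l).map z) ⊔ maximalIdeal B ^ 2 := by
    have : d l * z l = (d l * z l + ∑ i ∈ Finset.univ.erase l, d i * z i) - ∑ i ∈ Finset.univ.erase l, d i * z i := by ring
    rw [this]
    exact Ideal.sub_mem _ (Ideal.mem_sup_right ht) (Ideal.mem_sup_left hrest)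
  have := Ideal.mul_mem_left _ (↑hdl.unit⁻¹ : B) key
  rwa [← mul_assoc, IsUnit.val_inv_mul, one_mul] at this

include hφθ hφ in
/-- ★★ **SWAPPING IN A SECOND FUNCTION THROUGH A `2 × 2` MINOR.** If `θ(c) = w(c) = 0`, `∂θ/∂y_l(c) ≠ 0`, `i₀ ≠ l` and the minor `∂_lθ(c)·∂_{i₀}w(c) − ∂_{i₀}θ(c)·∂_l w(c) ≠ 0`, then `φ w`
together with the `φ(yᵢ − cᵢ)`, `i ≠ l, i₀`, generates `𝔪_B`. [cite: Matsumura1987, Thm. 2.3; Hartshorne1977, I Thm. 5.1] -/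
theorem ofList_swap_eq_maximalIdeal (hθ : eval c θ = 0) (l : Fin n) (hl : eval c (pderiv l θ) ≠ 0) (w : MvPolynomial (Fin n) k) (hw : eval c w = 0)
    (i₀ : Fin n) (hi₀ : i₀ ≠ l) (hminor : eval c (pderiv l θ) * eval c (pderiv i₀ w) - eval c (pderiv i₀ θ) * eval c (pderiv l w) ≠ 0)
    (z : Fin n → B) (hz : ∀ i, z i = φ (X i - C (c i))) :
    Ideal.ofList (φ w :: (((List.finRange n).erase l).erase i₀).map z) = maximalIdeal B := by
  classical
  -- the auxiliary polynomial `W' = ∂_lθ(c)·w − ∂_l w(c)·θ`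
  obtain ⟨W', hW'⟩ : ∃ W' : MvPolynomial (Fin n) k, W' = C (eval c (pderiv l θ)) * w - C (eval c (pderiv l w)) * θ := ⟨_, rfl⟩
  have hW'0 : eval c W' = 0 := by rw [hW']; simp [hθ, hw]
  have hdW' : ∀ i, eval c (pderiv i W') = eval c (pderiv l θ) * eval c (pderiv i w) - eval c (pderiv i θ) * eval c (pderiv l w) := by
    intro i
    rw [hW']
    simp only [map_sub, pderiv_C_mul, map_mul, eval_C]
    ring
  have hdW'l : eval c (pderiv l W') = 0 := by rw [hdW']; ring
  obtain ⟨e, he⟩ : ∃ e : Fin n → B, ∀ i, e i = φ (C (eval c (pderiv i W'))) := ⟨_, fun i => rfl⟩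
  -- `𝔪 = (z_{i₀}, z_i : i ≠ l, i₀)` from the previous theorem
  have hmem : i₀ ∈ (List.finRange n).erase l := (List.mem_erase_of_ne hi₀).mpr (List.mem_finRange i₀)
  have hperm : (((List.finRange n).erase l).map z).Perm (z i₀ :: (((List.finRange n).erase l).erase i₀).map z) := by
    rw [← List.map_cons]
    exact (List.perm_cons_erase hmem).map z
  have hgen : Ideal.ofList (z i₀ :: (((List.finRange n).erase l).erase i₀).map z) = maximalIdeal B := by
    rw [← ofList_eq_of_perm hperm]; exact ofList_erase_eq_maximalIdeal θ c φ hφθ hφ hθ l hl z hz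
  -- Taylor for `W'`: `φ(∂_lθ(c))·φ w - Σ_i eᵢ zᵢ ∈ 𝔪²`, and `e_l = 0`
  have hφW' : φ W' = φ (C (eval c (pderiv l θ))) * φ w := by
    rw [hW', map_sub, map_mul, map_mul, hφθ, mul_zero, sub_zero]
  have ht : φ (C (eval c (pderiv l θ))) * φ w - ∑ i : Fin n, e i * z i ∈ maximalIdeal B ^ 2 := by
    have h := image_sub_sum_mem_sq c φ hφ W' hW'0 z hz
    rw [hφW'] at h
    have hef : (fun i => φ (C (eval c (pderiv i W'))) * z i) = fun i => e i * z i := funext fun i => by rw [he]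
    rwa [hef] at h
  have hel : e l = 0 := by rw [he, hdW'l, C_0, map_zero]
  rw [← Finset.add_sum_erase Finset.univ _ (Finset.mem_univ l), hel, zero_mul, zero_add,
    ← Finset.add_sum_erase (Finset.univ.erase l) _ (Finset.mem_erase.mpr ⟨hi₀, Finset.mem_univ i₀⟩)] at ht
  have hrest : ∑ i ∈ (Finset.univ.erase l).erase i₀, e i * z i ∈ Ideal.ofList ((((List.finRange n).erase l).erase i₀).map z) := by
    refine Ideal.sum_mem _ fun i hi => Ideal.mul_mem_left _ _ (Ideal.subset_span ?_)
    simp only [Finset.mem_erase] at hi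
    refine List.mem_map.mpr ⟨i, ?_, rfl⟩
    exact (List.mem_erase_of_ne hi.1).mpr ((List.mem_erase_of_ne hi.2.1).mpr (List.mem_finRange i))
  -- apply the swap lemma to `φ(∂_lθ(c))·φ w`, then remove the unit
  have hunit : IsUnit (e i₀) := by rw [he, hdW']; exact isUnit_map_C φ _ hminor
  have haunit : IsUnit (φ (C (eval c (pderiv l θ)))) := isUnit_map_C φ _ hl
  have hwm : φ w ∈ maximalIdeal B := map_mem_maximalIdeal c φ hφ w hw
  have hswap := ofList_cons_eq_of_sub_mem (z i₀) (φ (C (eval c (pderiv l θ))) * φ w) (e i₀) _ hgen (Ideal.mul_mem_left _ _ hwm) hunit ?_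
  · rw [Ideal.ofList_cons] at hswap ⊢
    rwa [Ideal.span_singleton_mul_left_unit haunit] at hswap
  · have : φ (C (eval c (pderiv l θ))) * φ w - e i₀ * z i₀ =
        (φ (C (eval c (pderiv l θ))) * φ w - (e i₀ * z i₀ + ∑ i ∈ (Finset.univ.erase l).erase i₀, e i * z i)) + ∑ i ∈ (Finset.univ.erase l).erase i₀, e i * z i := by ring
    rw [this]
    exact Ideal.add_mem _ (Ideal.mem_sup_right ht) (Ideal.mem_sup_left hrest)

end Point

end Summit.ResolutionOfSingularities.ResolutionOfSingularities.Theorems.FInjectiveMacaulayfication.ChartPointParameters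

end
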